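import Literature.AlgebraicGeometry.HodgeTheory.DirectImageCovering
import HarnessLib

/-!
# Restrictions of global classes to the fibres: rank, independence and spanning are locally constant

Topic `Literature/AlgebraicGeometry/HodgeTheory` (family `hodge`). Theorems only (no definition, no
named fact; D-0026).

For a family `π : 𝒳 ⟶ S` of `ℂ`-schemes and global classes `A₁, …, A_N ∈ Hᵏ(𝒳(ℂ); ℂ)`, the
restrictions `Aᵢ|_{𝒳_s} = ι_s^* Aᵢ ∈ Hᵏ(𝒳_s(ℂ); ℂ)` form, as `s` moves in the cohomologically
locally trivial locus `U ⊆ S(ℂ)` of `π` (`IsCohomologicallyLocallyTrivialOn π U`,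
`HodgeTheory/DirectImageCovering`: arbitrarily small opens `B ∋ s` over which restriction from the
tube `Hᵏ(π⁻¹B(ℂ)) → Hᵏ(𝒳_s(ℂ))` is bijective — Ehresmann + homotopy invariance for smooth projective
families, `isCohomologicallyLocallyTrivialOn_univ_of_smooth`), FLAT sections of the local system
`Rᵏ π_* ℂ` (Voisin, *Hodge Theory I*, §9.2.1; *Hodge Theory II*, §3.1.1: "the class `α_s` is the
restriction of a class on the total space, hence is flat"). Consequently every property of the tuple
`(A₁|_{𝒳_s}, …, A_N|_{𝒳_s})` which is invariant under linear isomorphisms — its rank, its linear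
independence, whether it spans, whether one member vanishes — is LOCALLY CONSTANT in `s ∈ U`, hence
constant on connected parts of `U` ("a flat section vanishing at one point vanishes identically").
This is the form in which the printed spreading arguments use flatness: D. Arapura, *Hodge cycles
and the Leray filtration* (2022), proof of Cor. 1.5 ("`[𝒵_1], …, [𝒵_N]` gives a basis of `R²f_*ℚ`" —
spanning at one fibre propagates); C. Voisin, *Hodge Theory II*, §3.3.1.

* `exists_nhds_linearEquiv_map_fiberι` — near `s₀ ∈ U`, linear isomorphisms
  `φ_s : Hᵏ(𝒳_{s₀}) ≃ Hᵏ(𝒳_s)` carrying `A|_{𝒳_{s₀}}` to `A|_{𝒳_s}` for EVERY global class `A`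
  (`φ_s = r_s ∘ r_{s₀}⁻¹` for the tube restrictions `r`, `fiberRestrict_restrictTube_apply`);
* `exists_nhds_forall_iff` — hence, near `s₀`, `finrank span`, linear independence, spanning and
  vanishing of the restricted tuple agree with their values at `s₀`;
* `isOpen_setOf_…` / `isClopen`-type statements on `U` and the constancy statements on a
  preconnected `U` (`…_of_isPreconnected`) and on a connected `S(ℂ)` with `U = univ`:
  `map_fiberι_ne_zero_of_ne_zero`, `linearIndependent_map_fiberι_of_linearIndependent`,
  `span_map_fiberι_eq_top_of_eq_top`, `finrank_span_map_fiberι_eq`.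

## References

* [VoisinHodgeI2002] C. Voisin, Hodge Theory and Complex Algebraic Geometry I (CUP 2002), §9.2.1,
  Thm. 9.3.
* [VoisinHodgeII2003] C. Voisin, Hodge Theory and Complex Algebraic Geometry II (CUP 2003), §3.1.1,
  §3.3.1.
* [Arapura2022] D. Arapura, Hodge cycles and the Leray filtration, Pacific J. Math. 319 (2022),
  proof of Cor. 1.5.
-/

noncomputable section

open CategoryTheory AlgebraicGeometry
open _root_.Topology _root_.Filter
open Literature.AlgebraicTopology.SingularHomology

namespace Literature.AlgebraicGeometry.HodgeTheory

section HodgeTheory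

variable {𝒳 S : Motives.SchemeOver ℂ} (π : 𝒳 ⟶ S) (k : ℕ)

/-! ### Flat transport of restricted global classes near a point -/

/-- **Restrictions of global classes are flat.** On the cohomologically locally trivial locus `U`
of `π`, every `s₀ ∈ U` has an open neighbourhood `B ⊆ U` such that for each `s ∈ B` there is a
linear isomorphism `φ : Hᵏ(𝒳_{s₀}(ℂ); ℂ) ≃ Hᵏ(𝒳_s(ℂ); ℂ)` with `φ (A|_{𝒳_{s₀}}) = A|_{𝒳_s}` for
EVERY global class `A ∈ Hᵏ(𝒳(ℂ); ℂ)`: both restrictions factor through the tube `Hᵏ(π⁻¹B(ℂ))`,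
from which restriction to either fibre is bijective. (Voisin I §9.2.1: the stalks of `Rᵏ π_* ℂ`
are the `Hᵏ(𝒳_s)` by restriction; Voisin II §3.1.1.) [cite: VoisinHodgeI2002, §9.2.1]
[cite: VoisinHodgeII2003, §3.1.1] -/
theorem exists_nhds_linearEquiv_map_fiberι {U : Set (Motives.ComplexPoints S)}
    (hU : IsCohomologicallyLocallyTrivialOn π U) {s₀ : Motives.ComplexPoints S} (hs₀ : s₀ ∈ U) :
    ∃ B : Set (Motives.ComplexPoints S), IsOpen B ∧ s₀ ∈ B ∧ B ⊆ U ∧ ∀ s ∈ B,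
      ∃ φ : complexBetti (Motives.fiberOver π s₀) k ≃ₗ[ℂ] complexBetti (Motives.fiberOver π s) k,
        ∀ A : complexBetti 𝒳 k,
          φ (complexBetti.map (Motives.fiberι π s₀) k A) = complexBetti.map (Motives.fiberι π s) k A := by
  obtain ⟨B, hBo, hs₀B, -, hBU, hbij⟩ := hU.exists_nhds_bijective hs₀ Set.univ univ_mem
  refine ⟨B, hBo, hs₀B, hBU, fun s hs => ?_⟩
  let e₀ : singularCohomology ℂ ℂ (tubeOver π B) k ≃ₗ[ℂ] complexBetti (Motives.fiberOver π s₀) k :=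
    LinearEquiv.ofBijective (fiberRestrict π hs₀B k).hom (hbij k hs₀B)
  let e : singularCohomology ℂ ℂ (tubeOver π B) k ≃ₗ[ℂ] complexBetti (Motives.fiberOver π s) k :=
    LinearEquiv.ofBijective (fiberRestrict π hs k).hom (hbij k hs)
  refine ⟨e₀.symm.trans e, fun A => ?_⟩
  have h₀ : e₀ (restrictTube π B k A) = complexBetti.map (Motives.fiberι π s₀) k A :=
    fiberRestrict_restrictTube_apply π hs₀B k A
  have h : e (restrictTube π B k A) = complexBetti.map (Motives.fiberι π s) k A :=
    fiberRestrict_restrictTube_apply π hs k A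
  rw [LinearEquiv.trans_apply, ← h₀, LinearEquiv.symm_apply_apply, h]

/-! ### Linear algebra: transport of a tuple along a linear isomorphism -/

/-- A linear isomorphism preserves the rank of the span of a family. [folklore] -/
theorem finrank_span_range_comp_linearEquiv {V W : Type*} [AddCommGroup V] [Module ℂ V]
    [AddCommGroup W] [Module ℂ W] (φ : V ≃ₗ[ℂ] W) {ι : Type*} (v : ι → V) :
    Module.finrank ℂ (Submodule.span ℂ (Set.range (φ ∘ v))) =
      Module.finrank ℂ (Submodule.span ℂ (Set.range v)) := by
  have h : Submodule.span ℂ (Set.range (φ ∘ v)) =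
      (Submodule.span ℂ (Set.range v)).map (φ : V →ₗ[ℂ] W) := by
    rw [Submodule.map_span, Set.range_comp]
    rfl
  rw [h]
  exact LinearEquiv.finrank_map_eq φ _

/-- A linear isomorphism preserves linear independence of a family. [folklore] -/
theorem linearIndependent_comp_linearEquiv_iff {V W : Type*} [AddCommGroup V] [Module ℂ V]
    [AddCommGroup W] [Module ℂ W] (φ : V ≃ₗ[ℂ] W) {ι : Type*} (v : ι → V) :
    LinearIndependent ℂ (φ ∘ v) ↔ LinearIndependent ℂ v :=
  LinearMap.linearIndependent_iff φ.toLinearMap (LinearMap.ker_eq_bot.2 φ.injective)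

/-- A linear isomorphism preserves "the family spans". [folklore] -/
theorem span_range_comp_linearEquiv_eq_top_iff {V W : Type*} [AddCommGroup V] [Module ℂ V]
    [AddCommGroup W] [Module ℂ W] (φ : V ≃ₗ[ℂ] W) {ι : Type*} (v : ι → V) :
    Submodule.span ℂ (Set.range (φ ∘ v)) = ⊤ ↔ Submodule.span ℂ (Set.range v) = ⊤ := by
  have h : Submodule.span ℂ (Set.range (φ ∘ v)) =
      (Submodule.span ℂ (Set.range v)).map (φ : V →ₗ[ℂ] W) := by
    rw [Submodule.map_span, Set.range_comp]
    rfl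
  rw [h]
  constructor
  · intro h'
    apply_fun Submodule.comap (φ : V →ₗ[ℂ] W) at h'
    rwa [Submodule.comap_map_eq_of_injective φ.injective, Submodule.comap_top] at h'
  · intro h'
    rw [h', Submodule.map_top, LinearMap.range_eq_top]
    exact φ.surjective

/-! ### Local constancy near a point of the locally trivial locus -/

variable {π k}

/-- **Near a point of the locally trivial locus the restricted tuple keeps its rank, its
(in)dependence, its spanning and the vanishing of each member.** For global classes
`A : ι → Hᵏ(𝒳(ℂ); ℂ)` and `s₀ ∈ U`, on an open neighbourhood `B ⊆ U` of `s₀`: the rank of the span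
of `(Aᵢ|_{𝒳_s})ᵢ`, their linear independence, whether they span `Hᵏ(𝒳_s(ℂ); ℂ)`, and for each `i`
whether `Aᵢ|_{𝒳_s} = 0`, are the same at `s` as at `s₀` (flat transport,
`exists_nhds_linearEquiv_map_fiberι`). [cite: VoisinHodgeII2003, §3.1.1] [cite: VoisinHodgeI2002, §9.2.1] -/
theorem exists_nhds_forall_iff {U : Set (Motives.ComplexPoints S)}
    (hU : IsCohomologicallyLocallyTrivialOn π U) {s₀ : Motives.ComplexPoints S} (hs₀ : s₀ ∈ U)
    {ι : Type*} (A : ι → complexBetti 𝒳 k) :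
    ∃ B : Set (Motives.ComplexPoints S), IsOpen B ∧ s₀ ∈ B ∧ B ⊆ U ∧ ∀ s ∈ B,
      Module.finrank ℂ (Submodule.span ℂ (Set.range fun i => complexBetti.map (Motives.fiberι π s) k (A i))) =
        Module.finrank ℂ (Submodule.span ℂ (Set.range fun i => complexBetti.map (Motives.fiberι π s₀) k (A i))) ∧
      (LinearIndependent ℂ (fun i => complexBetti.map (Motives.fiberι π s) k (A i)) ↔
        LinearIndependent ℂ (fun i => complexBetti.map (Motives.fiberι π s₀) k (A i))) ∧
      (Submodule.span ℂ (Set.range fun i => complexBetti.map (Motives.fiberι π s) k (A i)) = ⊤ ↔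
        Submodule.span ℂ (Set.range fun i => complexBetti.map (Motives.fiberι π s₀) k (A i)) = ⊤) ∧
      ∀ i, (complexBetti.map (Motives.fiberι π s) k (A i) = 0 ↔
        complexBetti.map (Motives.fiberι π s₀) k (A i) = 0) := by
  obtain ⟨B, hBo, hs₀B, hBU, hφ⟩ := exists_nhds_linearEquiv_map_fiberι π k hU hs₀
  refine ⟨B, hBo, hs₀B, hBU, fun s hs => ?_⟩
  obtain ⟨φ, hφA⟩ := hφ s hs
  have hcomp : (fun i => complexBetti.map (Motives.fiberι π s) k (A i)) =
      φ ∘ fun i => complexBetti.map (Motives.fiberι π s₀) k (A i) := by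
    funext i
    exact (hφA (A i)).symm
  refine ⟨?_, ?_, ?_, fun i => ?_⟩
  · rw [hcomp]
    exact finrank_span_range_comp_linearEquiv φ _
  · rw [hcomp]
    exact linearIndependent_comp_linearEquiv_iff φ _
  · rw [hcomp]
    exact span_range_comp_linearEquiv_eq_top_iff φ _
  · rw [← hφA (A i)]
    exact φ.map_eq_zero_iff

/-- **The rank of the span of the restrictions is locally constant on `U`.**
[cite: VoisinHodgeII2003, §3.1.1] -/
theorem isLocallyConstant_finrank_span_map_fiberι {U : Set (Motives.ComplexPoints S)}
    (hU : IsCohomologicallyLocallyTrivialOn π U) {ι : Type*} (A : ι → complexBetti 𝒳 k) :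
    IsLocallyConstant fun s : U => Module.finrank ℂ
      (Submodule.span ℂ (Set.range fun i => complexBetti.map (Motives.fiberι π s.1) k (A i))) := by
  refine (IsLocallyConstant.iff_exists_open _).2 fun s₀ => ?_
  obtain ⟨B, hBo, hs₀B, -, hB⟩ := exists_nhds_forall_iff hU s₀.2 A
  refine ⟨Subtype.val ⁻¹' B, hBo.preimage continuous_subtype_val, hs₀B, fun s hs => ?_⟩
  exact (hB s.1 hs).1

/-- **The locus in `U` where the restrictions are linearly independent is open** (and so is the
locus where they are dependent). [cite: VoisinHodgeII2003, §3.1.1] -/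
theorem isOpen_setOf_linearIndependent_map_fiberι {U : Set (Motives.ComplexPoints S)}
    (hU : IsCohomologicallyLocallyTrivialOn π U) {ι : Type*} (A : ι → complexBetti 𝒳 k) :
    IsOpen {s | s ∈ U ∧ LinearIndependent ℂ fun i => complexBetti.map (Motives.fiberι π s) k (A i)} := by
  rw [isOpen_iff_mem_nhds]
  rintro s₀ ⟨hs₀, hli⟩
  obtain ⟨B, hBo, hs₀B, hBU, hB⟩ := exists_nhds_forall_iff hU hs₀ A
  exact mem_of_superset (hBo.mem_nhds hs₀B) fun s hs => ⟨hBU hs, (hB s hs).2.1.2 hli⟩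

/-- The dependence locus in `U` is open. [cite: VoisinHodgeII2003, §3.1.1] -/
theorem isOpen_setOf_not_linearIndependent_map_fiberι {U : Set (Motives.ComplexPoints S)}
    (hU : IsCohomologicallyLocallyTrivialOn π U) {ι : Type*} (A : ι → complexBetti 𝒳 k) :
    IsOpen {s | s ∈ U ∧ ¬ LinearIndependent ℂ fun i => complexBetti.map (Motives.fiberι π s) k (A i)} := by
  rw [isOpen_iff_mem_nhds]
  rintro s₀ ⟨hs₀, hli⟩
  obtain ⟨B, hBo, hs₀B, hBU, hB⟩ := exists_nhds_forall_iff hU hs₀ A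
  exact mem_of_superset (hBo.mem_nhds hs₀B) fun s hs => ⟨hBU hs, fun h => hli ((hB s hs).2.1.1 h)⟩

/-- **The locus in `U` where the restrictions span `Hᵏ` of the fibre is open**, and so is the locus
where they do not. [cite: Arapura2022, proof of Cor. 1.5] [cite: VoisinHodgeII2003, §3.1.1] -/
theorem isOpen_setOf_span_map_fiberι_eq_top {U : Set (Motives.ComplexPoints S)}
    (hU : IsCohomologicallyLocallyTrivialOn π U) {ι : Type*} (A : ι → complexBetti 𝒳 k) :
    IsOpen {s | s ∈ U ∧ Submodule.span ℂ
      (Set.range fun i => complexBetti.map (Motives.fiberι π s) k (A i)) = ⊤} := by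
  rw [isOpen_iff_mem_nhds]
  rintro s₀ ⟨hs₀, htop⟩
  obtain ⟨B, hBo, hs₀B, hBU, hB⟩ := exists_nhds_forall_iff hU hs₀ A
  exact mem_of_superset (hBo.mem_nhds hs₀B) fun s hs => ⟨hBU hs, (hB s hs).2.2.1.2 htop⟩

/-- The non-spanning locus in `U` is open. [cite: VoisinHodgeII2003, §3.1.1] -/
theorem isOpen_setOf_span_map_fiberι_ne_top {U : Set (Motives.ComplexPoints S)}
    (hU : IsCohomologicallyLocallyTrivialOn π U) {ι : Type*} (A : ι → complexBetti 𝒳 k) :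
    IsOpen {s | s ∈ U ∧ Submodule.span ℂ
      (Set.range fun i => complexBetti.map (Motives.fiberι π s) k (A i)) ≠ ⊤} := by
  rw [isOpen_iff_mem_nhds]
  rintro s₀ ⟨hs₀, htop⟩
  obtain ⟨B, hBo, hs₀B, hBU, hB⟩ := exists_nhds_forall_iff hU hs₀ A
  exact mem_of_superset (hBo.mem_nhds hs₀B) fun s hs => ⟨hBU hs, fun h => htop ((hB s hs).2.2.1.1 h)⟩

/-- **The vanishing locus `{s ∈ U | A|_{𝒳_s} = 0}` of a global class is open**, and so is the
non-vanishing locus. [cite: VoisinHodgeII2003, §3.1.1] -/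
theorem isOpen_setOf_map_fiberι_eq_zero {U : Set (Motives.ComplexPoints S)}
    (hU : IsCohomologicallyLocallyTrivialOn π U) (A : complexBetti 𝒳 k) :
    IsOpen {s | s ∈ U ∧ complexBetti.map (Motives.fiberι π s) k A = 0} := by
  rw [isOpen_iff_mem_nhds]
  rintro s₀ ⟨hs₀, h0⟩
  obtain ⟨B, hBo, hs₀B, hBU, hB⟩ := exists_nhds_forall_iff hU hs₀ (fun _ : Unit => A)
  exact mem_of_superset (hBo.mem_nhds hs₀B) fun s hs => ⟨hBU hs, ((hB s hs).2.2.2 ()).2 h0⟩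

/-- The non-vanishing locus in `U` of a global class is open. [cite: VoisinHodgeII2003, §3.1.1] -/
theorem isOpen_setOf_map_fiberι_ne_zero {U : Set (Motives.ComplexPoints S)}
    (hU : IsCohomologicallyLocallyTrivialOn π U) (A : complexBetti 𝒳 k) :
    IsOpen {s | s ∈ U ∧ complexBetti.map (Motives.fiberι π s) k A ≠ 0} := by
  rw [isOpen_iff_mem_nhds]
  rintro s₀ ⟨hs₀, h0⟩
  obtain ⟨B, hBo, hs₀B, hBU, hB⟩ := exists_nhds_forall_iff hU hs₀ (fun _ : Unit => A)
  exact mem_of_superset (hBo.mem_nhds hs₀B) fun s hs => ⟨hBU hs, fun h => h0 (((hB s hs).2.2.2 ()).1 h)⟩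

/-! ### Constancy on preconnected parts of the locally trivial locus -/

/-- A subset of a preconnected `U` which is open, and whose complement in `U` is open, is empty or
all of `U`: if it contains `s₀ ∈ U` it contains every `s ∈ U`. [folklore] -/
theorem mem_of_isPreconnected_of_isOpen {U P : Set (Motives.ComplexPoints S)} (hUc : IsPreconnected U)
    (hP : IsOpen {s | s ∈ U ∧ s ∈ P}) (hP' : IsOpen {s | s ∈ U ∧ s ∉ P}) {s₀ s : Motives.ComplexPoints S}
    (hs₀ : s₀ ∈ U) (hs₀P : s₀ ∈ P) (hs : s ∈ U) : s ∈ P := by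
  by_contra hsP
  have h := hUc _ _ hP hP' (fun x hx => by
      by_cases hxP : x ∈ P
      · exact Or.inl ⟨hx, hxP⟩
      · exact Or.inr ⟨hx, hxP⟩)
    ⟨s₀, hs₀, hs₀, hs₀P⟩ ⟨s, hs, hs, hsP⟩
  obtain ⟨x, -, ⟨-, hxP⟩, ⟨-, hxP'⟩⟩ := h
  exact hxP' hxP

/-- **A flat section vanishing at one point vanishes on the whole preconnected `U`; equivalently a
restriction `A|_{𝒳_{s₀}} ≠ 0` forces `A|_{𝒳_s} ≠ 0` for all `s ∈ U`.**
[cite: VoisinHodgeII2003, §3.1.1] [cite: Arapura2022, proof of Cor. 1.5] -/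
theorem map_fiberι_ne_zero_of_isPreconnected {U : Set (Motives.ComplexPoints S)}
    (hU : IsCohomologicallyLocallyTrivialOn π U) (hUc : IsPreconnected U) (A : complexBetti 𝒳 k)
    {s₀ s : Motives.ComplexPoints S} (hs₀ : s₀ ∈ U) (hs : s ∈ U)
    (h₀ : complexBetti.map (Motives.fiberι π s₀) k A ≠ 0) :
    complexBetti.map (Motives.fiberι π s) k A ≠ 0 := by
  have h := mem_of_isPreconnected_of_isOpen (P := {s | complexBetti.map (Motives.fiberι π s) k A ≠ 0})
    hUc (isOpen_setOf_map_fiberι_ne_zero hU A) ?_ hs₀ h₀ hs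
  · exact h
  · convert isOpen_setOf_map_fiberι_eq_zero hU A using 2 with s
    simp only [Set.mem_setOf_eq, not_not]

/-- **Linear independence of the restrictions at one point of a preconnected `U` gives it at every
point of `U`.** [cite: VoisinHodgeII2003, §3.1.1] -/
theorem linearIndependent_map_fiberι_of_isPreconnected {U : Set (Motives.ComplexPoints S)}
    (hU : IsCohomologicallyLocallyTrivialOn π U) (hUc : IsPreconnected U) {ι : Type*}
    (A : ι → complexBetti 𝒳 k) {s₀ s : Motives.ComplexPoints S} (hs₀ : s₀ ∈ U) (hs : s ∈ U)
    (h₀ : LinearIndependent ℂ fun i => complexBetti.map (Motives.fiberι π s₀) k (A i)) :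
    LinearIndependent ℂ fun i => complexBetti.map (Motives.fiberι π s) k (A i) :=
  mem_of_isPreconnected_of_isOpen
    (P := {s | LinearIndependent ℂ fun i => complexBetti.map (Motives.fiberι π s) k (A i)}) hUc
    (isOpen_setOf_linearIndependent_map_fiberι hU A) (isOpen_setOf_not_linearIndependent_map_fiberι hU A)
    hs₀ h₀ hs

/-- **Spanning of `Hᵏ` of one fibre by the restrictions gives spanning of `Hᵏ` of every fibre over
the preconnected `U`** ("`[𝒵_1], …, [𝒵_N]` gives a basis of `R²f_*ℚ`": a basis at one point of the
connected base is a basis everywhere). [cite: Arapura2022, proof of Cor. 1.5] [cite: VoisinHodgeII2003, §3.1.1] -/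
theorem span_map_fiberι_eq_top_of_isPreconnected {U : Set (Motives.ComplexPoints S)}
    (hU : IsCohomologicallyLocallyTrivialOn π U) (hUc : IsPreconnected U) {ι : Type*}
    (A : ι → complexBetti 𝒳 k) {s₀ s : Motives.ComplexPoints S} (hs₀ : s₀ ∈ U) (hs : s ∈ U)
    (h₀ : Submodule.span ℂ (Set.range fun i => complexBetti.map (Motives.fiberι π s₀) k (A i)) = ⊤) :
    Submodule.span ℂ (Set.range fun i => complexBetti.map (Motives.fiberι π s) k (A i)) = ⊤ :=
  mem_of_isPreconnected_of_isOpen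
    (P := {s | Submodule.span ℂ (Set.range fun i => complexBetti.map (Motives.fiberι π s) k (A i)) = ⊤})
    hUc (isOpen_setOf_span_map_fiberι_eq_top hU A) (isOpen_setOf_span_map_fiberι_ne_top hU A) hs₀ h₀ hs

/-- **The rank of the span of the restrictions is constant on a preconnected `U`.**
[cite: VoisinHodgeII2003, §3.1.1] -/
theorem finrank_span_map_fiberι_eq_of_isPreconnected {U : Set (Motives.ComplexPoints S)}
    (hU : IsCohomologicallyLocallyTrivialOn π U) (hUc : IsPreconnected U) {ι : Type*}
    (A : ι → complexBetti 𝒳 k) {s₀ s : Motives.ComplexPoints S} (hs₀ : s₀ ∈ U) (hs : s ∈ U) :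
    Module.finrank ℂ (Submodule.span ℂ (Set.range fun i => complexBetti.map (Motives.fiberι π s) k (A i))) =
      Module.finrank ℂ (Submodule.span ℂ (Set.range fun i => complexBetti.map (Motives.fiberι π s₀) k (A i))) := by
  have hloc := isLocallyConstant_finrank_span_map_fiberι hU A
  haveI : PreconnectedSpace U := Subtype.preconnectedSpace hUc
  exact hloc.apply_eq_of_preconnectedSpace ⟨s, hs⟩ ⟨s₀, hs₀⟩

/-! ### The whole base: `U = S(ℂ)` connected -/

/-- Over a base with connected `S(ℂ)` on which `π` is cohomologically locally trivial everywhere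
(e.g. a smooth projective family over a smooth irreducible base), a global class restricting
non-trivially to ONE fibre restricts non-trivially to EVERY fibre.
[cite: VoisinHodgeII2003, §3.1.1] [cite: Arapura2022, proof of Cor. 1.5] -/
theorem map_fiberι_ne_zero_of_ne_zero [ConnectedSpace (Motives.ComplexPoints S)]
    (hU : IsCohomologicallyLocallyTrivialOn π (Set.univ : Set (Motives.ComplexPoints S)))
    (A : complexBetti 𝒳 k) {s₀ : Motives.ComplexPoints S}
    (h₀ : complexBetti.map (Motives.fiberι π s₀) k A ≠ 0) (s : Motives.ComplexPoints S) :
    complexBetti.map (Motives.fiberι π s) k A ≠ 0 :=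
  map_fiberι_ne_zero_of_isPreconnected hU isPreconnected_univ A (Set.mem_univ s₀) (Set.mem_univ s) h₀

/-- Over a base with connected `S(ℂ)`, linear independence of the restrictions at one fibre gives it
at every fibre. [cite: VoisinHodgeII2003, §3.1.1] -/
theorem linearIndependent_map_fiberι_of_linearIndependent [ConnectedSpace (Motives.ComplexPoints S)]
    (hU : IsCohomologicallyLocallyTrivialOn π (Set.univ : Set (Motives.ComplexPoints S))) {ι : Type*}
    (A : ι → complexBetti 𝒳 k) {s₀ : Motives.ComplexPoints S}
    (h₀ : LinearIndependent ℂ fun i => complexBetti.map (Motives.fiberι π s₀) k (A i))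
    (s : Motives.ComplexPoints S) :
    LinearIndependent ℂ fun i => complexBetti.map (Motives.fiberι π s) k (A i) :=
  linearIndependent_map_fiberι_of_isPreconnected hU isPreconnected_univ A (Set.mem_univ s₀)
    (Set.mem_univ s) h₀

/-- Over a base with connected `S(ℂ)`, if the restrictions span `Hᵏ` of one fibre they span `Hᵏ` of
every fibre. [cite: Arapura2022, proof of Cor. 1.5] [cite: VoisinHodgeII2003, §3.1.1] -/
theorem span_map_fiberι_eq_top_of_eq_top [ConnectedSpace (Motives.ComplexPoints S)]
    (hU : IsCohomologicallyLocallyTrivialOn π (Set.univ : Set (Motives.ComplexPoints S))) {ι : Type*}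
    (A : ι → complexBetti 𝒳 k) {s₀ : Motives.ComplexPoints S}
    (h₀ : Submodule.span ℂ (Set.range fun i => complexBetti.map (Motives.fiberι π s₀) k (A i)) = ⊤)
    (s : Motives.ComplexPoints S) :
    Submodule.span ℂ (Set.range fun i => complexBetti.map (Motives.fiberι π s) k (A i)) = ⊤ :=
  span_map_fiberι_eq_top_of_isPreconnected hU isPreconnected_univ A (Set.mem_univ s₀) (Set.mem_univ s) h₀

/-- Over a base with connected `S(ℂ)`, the rank of the span of the restrictions is the same at all
fibres. [cite: VoisinHodgeII2003, §3.1.1] -/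
theorem finrank_span_map_fiberι_eq [ConnectedSpace (Motives.ComplexPoints S)]
    (hU : IsCohomologicallyLocallyTrivialOn π (Set.univ : Set (Motives.ComplexPoints S))) {ι : Type*}
    (A : ι → complexBetti 𝒳 k) (s₀ s : Motives.ComplexPoints S) :
    Module.finrank ℂ (Submodule.span ℂ (Set.range fun i => complexBetti.map (Motives.fiberι π s) k (A i))) =
      Module.finrank ℂ (Submodule.span ℂ (Set.range fun i => complexBetti.map (Motives.fiberι π s₀) k (A i))) :=
  finrank_span_map_fiberι_eq_of_isPreconnected hU isPreconnected_univ A (Set.mem_univ s₀) (Set.mem_univ s)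

end HodgeTheory

end Literature.AlgebraicGeometry.HodgeTheory

end
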